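import Summits.QuantumFields.BalabanUV.Beta.EriceRemainderEnclosureHistoryAutonomyComparisonIsotoneExcessSharp
import Summits.QuantumFields.BalabanUV.Beta.EriceRemainderEnclosureHistoryAutonomyComparisonIsotoneExcess

/-!
# EriceRemainderEnclosureHistoryAutonomyComparisonIsotoneExcessSharpEnd — (E56b) (E50a′) IS FALSE AND (E49k)'s THRESHOLD CONSTANT `3√3` IS SHARP:
# «`B` isotone in the history with zeroth moment `M` and floor `b` on ]0,γ], `M·γ ≤ C·b`; `B′ ≥ B` with a zeroth moment and an ISOTONE excess;
# `h`, `h′` box solutions of `B`, `B′` from one pin ⟹ `h′ ≤ h` at every scale» HOLDS for `C = 3√3` ((E49k)) and FAILS for EVERY `C > 3√3`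
# (**`threshold_exact : (…) ↔ C ≤ 3√3`**); in particular the threshold-free conjecture (E50a′) («NO smallness») is refuted

Cell `pub-balaban`, β-function sub-cell, BINDER row D4 «RemainderConst leaves for Bałaban's split» (`HOME/BINDER-OWNERS.md`; owner lineage `b2b-balaban-beta-an4`;
this file by co-owner #2 lineage `b2b-balaban-beta-d4-p2`, generation 50), β-FLOW TEAM duty (1), FREEZE (0) honoured (def-free; (E56a)'s hinge construction
`memFlow_h` ∕ `memFlow_h'` ∕ `h_one_lt_h'_one` ∕ `B_isotone` ∕ `B_zerothMoment` ∕ …, (E49k)'s `le_of_isotone_excess` and (E38a)'s `three_sqrt_three_sq` BY NAME, nothing restated).  Closes the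
successor question (E50a′) of `HOME/b2b-balaban-beta-d4-p2/g46/E50a-DOSSIER.md` — in the NEGATIVE — and the comparison station (E49)∕(E50) with an EXACT
class constant.

HONEST FRAMING (page 1, verbatim and binding).  *"Discharging BetaPertH makes Bałaban's UV stability UNCONDITIONAL — a real constructive-QFT result; it is
NOT the continuum limit and NOT the Clay problem."*  THIS FILE DISCHARGES NOTHING OF THE KIND.  Elementary real analysis about ABSTRACT functionals on a box
]0,γ]^ℕ with DISPLAYED signs and moments — hypotheses of a census, not facts; which signs or moments Bałaban's (1.22) limit functional and its perturbations
have is NOT PRINTED ([I] p. 298; GAPS G-t4-U2-1∕-2) and NOT asserted.  Row D4 class UNCHANGED (critical-path width 0; instance 0∕1; D4 DISCHARGE NO DATE).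
HONEST DEPENDENCY: continuum YM on T⁴ ⇐ BetaPertH ∧ nine spine estimates (0/9 proved); BetaPertH ⇐ (D1) ∧ (D4) ∧ CAP+tail; G-an2-4 gates asym, D1 and
NE2/3/4.

THE POINT (census sense (α)).  §5 runs (E56a)'s construction along the one-parameter family `n ↦ (L, b, ε, x, η, M̃) = (n+3, 2∕(3(n+4)), 1∕((n+4)(n+2)(n+3)),
1∕((n+2)(n+3)²), 1∕(n+3)², 1∕(n+2))` — the age `L+1 = n+4` of the hinge is tuned to the pin by `(L+1)·b·γ² → 2∕3`, the point where (E49k)'s bookkeeping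
weight `k·c_k³` peaks — with pin level `a₀ = (n²+5n+3)∕(3(n+3)(n+2))`, box ]0,γ], `γ = p = 1∕√a₀`, zeroth moment `M = 2∕(n+2)`: EVERY hypothesis of (E49k) but
the threshold holds, `h 1 < h′ 1`, and **`M²γ² ≤ (27 + 189∕(n+1))·b²`** (`exists_violation`; the polynomial inequality `(n+4)²(n+3)(n+1) ≤ (n+8)(n+2)(n²+5n+3)`).
§6: `n = 0` refutes the threshold-free statement (**`not_le_of_isotone_excess_without_threshold`** — (E50a′) is FALSE: isotone memory AND isotone, even
CONSTANT, excess do NOT imply comparison); for `K > 3√3`, `n = ⌈189∕(K² − 27)⌉₊` gives an instance with `M·γ ≤ K·b` (**`exists_violation_of_gt`**,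
**`not_le_of_isotone_excess_of_gt`**); with (E49k) BY NAME, **`threshold_exact`**: the class statement with constant `C` holds IFF `C ≤ 3√3`.  So (E49k)'s
zeroth-moment bookkeeping is OPTIMAL: its worst case «all memory weight at the age maximising `k·c_k³`, all shifted excesses equal» is realised in the limit
`L → ∞` by a hinge memory silent outside a window of width `η → 0`; the dossier's probes missed it because LINEAR memories spend their moment at every scale
(levels grow by `b + M·h`, the leverage `h³` collapses), whereas a hinge spends it once.  Comparison in the functional therefore costs one sign AND — on the
isotone∕isotone side — the size condition `M·γ ≤ 3√3·b`, exactly.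

WHAT IS PROVED ([folklore]; 0 `def`, 0 sorry).  §5 **`exists_violation`**.  §6 **`not_le_of_isotone_excess_without_threshold`**,
**`exists_violation_of_gt`**, **`not_le_of_isotone_excess_of_gt`**, **`threshold_exact`**.
-/
noncomputable section
open Finset Set

namespace Summit.QuantumFields.BalabanUV.Beta.EriceRemainderEnclosureHistoryAutonomyComparisonIsotoneExcessSharpEnd

open Literature.MathematicalPhysics.QuantumFieldTheory.Balaban1983to89
open Literature.MathematicalPhysics.QuantumFieldTheory.Balaban1983to89.T4BetaStationary
open Literature.MathematicalPhysics.QuantumFieldTheory.Balaban1983to89.T4BetaFlowWellPosed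
open Summit.QuantumFields.BalabanUV.Beta.EriceRemainderEnclosureHistoryAutonomyComparisonIsotoneExcessSharp
open Summit.QuantumFields.BalabanUV.Beta.EriceRemainderEnclosureHistoryAutonomyComparisonIsotoneExcess (le_of_isotone_excess)
open Summit.QuantumFields.BalabanUV.Beta.EriceRemainderEnclosureHistoryAutonomyThreshold (three_sqrt_three_sq)

/-! ## §5 The one-parameter family `n ↦ (L, b, ε, x, η, M̃, a₀) = (n+3, 2∕(3(n+4)), …)`: every (E49k) hypothesis but the threshold, and `M·γ∕b ↓ 3√3` -/

/-- **THE FAMILY OF VIOLATIONS.**  For every `n : ℕ`, with lag `L = n+3`, floor `b = 2∕(3(n+4))`, hinge strength `M̃ = 1∕(n+2)` (zeroth moment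
`M = 2M̃ = 2∕(n+2)`), excess `ε = 1∕((n+4)(n+2)(n+3))`, pin level `a₀ = (n²+5n+3)∕(3(n+3)(n+2))` and box ]0,γ], `γ = p = 1∕√a₀`: the hinge memory `B`
and its translate `B′ = B + ε` satisfy EVERY hypothesis of (E49k) `le_of_isotone_excess` EXCEPT the threshold `M·γ ≤ 3√3·b` — `B` isotone with zeroth
moment `M`, floor `b`; `B′` with zeroth moment `M`, `B ≤ B′`, ISOTONE (constant) excess; `h`, `h′` box solutions of `B`, `B′` from the pin `p = γ` —
and yet **`h 1 < h′ 1`**; the size of the instance is **`M²γ² ≤ (27 + 189∕(n+1))·b²`**, i.e. `M·γ∕b ↓ 3√3` as `n → ∞`. [folklore] -/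
theorem exists_violation (n : ℕ) :
    ∃ (γ b M : ℝ) (B B' : (ℕ → ℝ) → ℝ) (p : ℝ) (h h' : ℕ → ℝ),
      (∀ u v : ℕ → ℝ, SeqBox γ u → SeqBox γ v → (∀ j, u j ≤ v j) → B u ≤ B v) ∧
      (∀ u u' : ℕ → ℝ, SeqBox γ u → SeqBox γ u' → ∀ D : ℝ, (∀ j, |u j - u' j| ≤ D) → |B u - B u'| ≤ M * D) ∧
      0 ≤ M ∧ 0 < b ∧ (∀ u, SeqBox γ u → b ≤ B u) ∧
      (∀ u u' : ℕ → ℝ, SeqBox γ u → SeqBox γ u' → ∀ D : ℝ, (∀ j, |u j - u' j| ≤ D) → |B' u - B' u'| ≤ M * D) ∧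
      (∀ u, SeqBox γ u → B u ≤ B' u) ∧
      (∀ u v : ℕ → ℝ, SeqBox γ u → SeqBox γ v → (∀ j, u j ≤ v j) → B' u - B u ≤ B' v - B v) ∧
      0 < p ∧ p ≤ γ ∧ SeqBox γ h ∧ MemFlow B p h ∧ SeqBox γ h' ∧ MemFlow B' p h' ∧
      h 1 < h' 1 ∧ M ^ 2 * γ ^ 2 ≤ (27 + 189 / ((n : ℝ) + 1)) * b ^ 2 := by
  have hn : (0 : ℝ) ≤ n := Nat.cast_nonneg n
  -- the parameters
  set L : ℕ := n + 3 with hL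
  set b : ℝ := 2 / (3 * ((n : ℝ) + 4)) with hb
  set ε : ℝ := 1 / (((n : ℝ) + 4) * ((n : ℝ) + 2) * ((n : ℝ) + 3)) with hεdef
  set x : ℝ := 1 / (((n : ℝ) + 2) * ((n : ℝ) + 3) ^ 2) with hxdef
  set η : ℝ := 1 / ((n : ℝ) + 3) ^ 2 with hηdef
  set Mt : ℝ := 1 / ((n : ℝ) + 2) with hMtdef
  set a₀ : ℝ := (((n : ℝ)) ^ 2 + 5 * n + 3) / (3 * ((n : ℝ) + 3) * ((n : ℝ) + 2)) with ha₀def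
  have hLr : ((L : ℕ) : ℝ) = (n : ℝ) + 3 := by rw [hL]; push_cast; ring
  have hb0 : 0 < b := by positivity
  have hε0 : 0 < ε := by positivity
  have hx0 : 0 < x := by positivity
  have hη0 : 0 < η := by positivity
  have hMt0 : 0 ≤ Mt := by positivity
  have ha₀0 : 0 < a₀ := by positivity
  have hεx : ε < x := by
    refine one_div_lt_one_div_of_lt (by positivity) ?_
    nlinarith [mul_pos (by positivity : (0 : ℝ) < n + 2) (by positivity : (0 : ℝ) < n + 3)]
  have hηb : η ≤ b := by
    rw [hηdef, hb, div_le_div_iff₀ (by positivity) (by positivity)]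
    nlinarith [sq_nonneg (n : ℝ)]
  have hη : η = ((L : ℝ) + 1) * ε - x := by rw [hLr, hηdef, hεdef, hxdef]; field_simp; ring
  have hMt : Mt * η = x := by rw [hMtdef, hηdef, hxdef]; field_simp
  have ha₀ : a₀ = 1 - η - ((L : ℝ) + 1) * b - x := by rw [hLr, ha₀def, hηdef, hb, hxdef]; field_simp; ring
  -- the levels
  have ha0 : (fun j : ℕ => if j = 0 then a₀ else 1 - η + ((j : ℝ) - 1 - L) * b) 0 = a₀ := if_pos rfl
  have haS : ∀ m : ℕ, (fun j : ℕ => if j = 0 then a₀ else 1 - η + ((j : ℝ) - 1 - L) * b) (m + 1) = 1 - η + ((m : ℝ) - L) * b :=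
    fun m => by simp only [Nat.succ_ne_zero, if_false]; push_cast; ring
  have ha'0 : (fun j : ℕ => if j = 0 then a₀ else 1 - η - x + ε + ((j : ℝ) - 1 - L) * b + ((j : ℝ) - 1) * ε) 0 = a₀ := if_pos rfl
  have ha'S : ∀ m : ℕ, (fun j : ℕ => if j = 0 then a₀ else 1 - η - x + ε + ((j : ℝ) - 1 - L) * b + ((j : ℝ) - 1) * ε) (m + 1) =
      1 - η - x + ε + ((m : ℝ) - L) * b + (m : ℝ) * ε :=
    fun m => by simp only [Nat.succ_ne_zero, if_false]; push_cast; ring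
  obtain ⟨hbox, hflow⟩ :=
    memFlow_h (Mt := Mt) (a := fun j : ℕ => if j = 0 then a₀ else 1 - η + ((j : ℝ) - 1 - L) * b) hb0 hη0 hηb hx0 hMt ha₀ ha₀0 ha0 haS
  obtain ⟨hbox', hflow'⟩ :=
    memFlow_h' (Mt := Mt) (a' := fun j : ℕ => if j = 0 then a₀ else 1 - η - x + ε + ((j : ℝ) - 1 - L) * b + ((j : ℝ) - 1) * ε)
      hb0 hε0 hη ha₀ ha₀0 ha'0 ha'S
  refine ⟨1 / Real.sqrt a₀, b, 2 * Mt, fun w : ℕ → ℝ => b + Mt * max (1 - 1 / w L ^ 2) 0,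
    fun w : ℕ → ℝ => b + Mt * max (1 - 1 / w L ^ 2) 0 + ε, 1 / Real.sqrt a₀, _, _,
    B_isotone hMt0, B_zerothMoment hMt0, by positivity, hb0, fun u _ => floor_le_B hMt0 u, B'_zerothMoment hMt0,
    fun u _ => B_le_B' hε0.le u, fun u v _ _ _ => excess_isotone u v, by positivity, le_rfl, hbox, hflow, hbox', hflow',
    h_one_lt_h'_one (a := fun j : ℕ => if j = 0 then a₀ else 1 - η + ((j : ℝ) - 1 - L) * b)
      (a' := fun j : ℕ => if j = 0 then a₀ else 1 - η - x + ε + ((j : ℝ) - 1 - L) * b + ((j : ℝ) - 1) * ε) hb0 hε0 hεx ha₀ ha₀0 haS ha'0 ha'S, ?_⟩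
  -- the size of the instance
  have e1 : (2 * Mt) ^ 2 * (1 / Real.sqrt a₀) ^ 2 = 12 * ((n : ℝ) + 3) / (((n : ℝ) + 2) * ((n : ℝ) ^ 2 + 5 * n + 3)) := by
    rw [div_pow, one_pow, Real.sq_sqrt ha₀0.le, hMtdef, ha₀def]
    field_simp
    ring
  have e2 : (27 + 189 / ((n : ℝ) + 1)) * b ^ 2 = 12 * ((n : ℝ) + 8) / (((n : ℝ) + 1) * ((n : ℝ) + 4) ^ 2) := by
    rw [hb]; field_simp; ring
  rw [e1, e2, div_le_div_iff₀ (by positivity) (by positivity)]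
  nlinarith [sq_nonneg (n : ℝ), mul_nonneg hn (sq_nonneg (n : ℝ)), mul_nonneg hn (mul_nonneg hn (sq_nonneg (n : ℝ)))]

/-! ## §6 ENDs: (E50a′) «isotone memory + isotone excess ⟹ comparison, NO smallness» is FALSE; (E49k)'s constant `3√3` is SHARP -/

/-- **(E50a′) REFUTED — COMPARISON IN THE FUNCTIONAL WITH ISOTONE EXCESS NEEDS A THRESHOLD.**  The hypotheses of (E49k) `le_of_isotone_excess`
WITHOUT its threshold `M·γ ≤ 3√3·b` — `B` isotone in the history with a zeroth moment `M` and a floor `b > 0`, `B′ ≥ B` with a zeroth moment and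
an ISOTONE excess `B′ − B`, `h`, `h′` box solutions of `B`, `B′` from one pin — do NOT imply `h′ ≤ h`: there is an instance (isotone hinge memory of age
`3`, CONSTANT excess, `M·γ = 6√6·b`) with `h 1 < h′ 1`.  Answers the question (E50a′) of `HOME/b2b-balaban-beta-d4-p2/g46/E50a-DOSSIER.md` (numerics
there — linear memories `b + M·u_K`, constant excesses — found no violation) in the NEGATIVE. [folklore] -/
theorem not_le_of_isotone_excess_without_threshold :
    ¬ ∀ (γ b M M' : ℝ) (B B' : (ℕ → ℝ) → ℝ) (p : ℝ) (h h' : ℕ → ℝ),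
      (∀ u v : ℕ → ℝ, SeqBox γ u → SeqBox γ v → (∀ j, u j ≤ v j) → B u ≤ B v) →
      (∀ u u' : ℕ → ℝ, SeqBox γ u → SeqBox γ u' → ∀ D : ℝ, (∀ j, |u j - u' j| ≤ D) → |B u - B u'| ≤ M * D) →
      0 ≤ M → 0 < b → (∀ u, SeqBox γ u → b ≤ B u) →
      (∀ u u' : ℕ → ℝ, SeqBox γ u → SeqBox γ u' → ∀ D : ℝ, (∀ j, |u j - u' j| ≤ D) → |B' u - B' u'| ≤ M' * D) → 0 ≤ M' →
      (∀ u, SeqBox γ u → B u ≤ B' u) →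
      (∀ u v : ℕ → ℝ, SeqBox γ u → SeqBox γ v → (∀ j, u j ≤ v j) → B' u - B u ≤ B' v - B v) →
      0 < p → p ≤ γ → SeqBox γ h → MemFlow B p h → SeqBox γ h' → MemFlow B' p h' → ∀ j, h' j ≤ h j := by
  intro H
  obtain ⟨γ, b, M, B, B', p, h, h', hmono, hB, hM, hb, hlo, hB', hexc, hDmono, hp, hpγ, hh, hf, hh', hf', hlt, -⟩ :=
    exists_violation 0
  exact absurd (H γ b M M B B' p h h' hmono hB hM hb hlo hB' hM hexc hDmono hp hpγ hh hf hh' hf' 1) (not_le.mpr hlt)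

/-- **(E49k)'s THRESHOLD CONSTANT `3√3` IS SHARP.**  For every `K > 3√3` there is an instance of all the hypotheses of `le_of_isotone_excess` except
the threshold, WITH `M·γ ≤ K·b` in its place, in which comparison fails at scale `1` (`h 1 < h′ 1`): the class constant in «`B` isotone, zeroth moment
`M`, floor `b`, `M·γ ≤ C·b`; isotone excess ⟹ `h′ ≤ h`» cannot be taken larger than `C = 3√3` — (E49k) proves it for `C = 3√3`.  Mechanism: ONE hinge
memory term of age `L` just above its activation point at scale `L+1` of the unperturbed trajectory; the accumulated excess `(L+1)·ε` of the perturbed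
trajectory switches it OFF, costing the level `x = M̃·η > ε` at scale `1`; optimising the age (`(L+1)·b·γ² → 2∕3`) and letting `L → ∞` drives `M·γ∕b`
down to (E49k)'s `3√3 = sup_k k·c_k³·b∕(2γ)`-value. [folklore] -/
theorem exists_violation_of_gt {K : ℝ} (hK : 3 * Real.sqrt 3 < K) :
    ∃ (γ b M M' : ℝ) (B B' : (ℕ → ℝ) → ℝ) (p : ℝ) (h h' : ℕ → ℝ),
      (∀ u v : ℕ → ℝ, SeqBox γ u → SeqBox γ v → (∀ j, u j ≤ v j) → B u ≤ B v) ∧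
      (∀ u u' : ℕ → ℝ, SeqBox γ u → SeqBox γ u' → ∀ D : ℝ, (∀ j, |u j - u' j| ≤ D) → |B u - B u'| ≤ M * D) ∧
      0 ≤ M ∧ 0 < b ∧ (∀ u, SeqBox γ u → b ≤ B u) ∧ M * γ ≤ K * b ∧
      (∀ u u' : ℕ → ℝ, SeqBox γ u → SeqBox γ u' → ∀ D : ℝ, (∀ j, |u j - u' j| ≤ D) → |B' u - B' u'| ≤ M' * D) ∧ 0 ≤ M' ∧
      (∀ u, SeqBox γ u → B u ≤ B' u) ∧
      (∀ u v : ℕ → ℝ, SeqBox γ u → SeqBox γ v → (∀ j, u j ≤ v j) → B' u - B u ≤ B' v - B v) ∧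
      0 < p ∧ p ≤ γ ∧ SeqBox γ h ∧ MemFlow B p h ∧ SeqBox γ h' ∧ MemFlow B' p h' ∧ h 1 < h' 1 := by
  have hK0 : 0 < K := lt_trans (by positivity) hK
  have hK2 : 27 < K ^ 2 := by
    rw [← three_sqrt_three_sq]; exact pow_lt_pow_left₀ hK (by positivity) two_ne_zero
  set n : ℕ := ⌈189 / (K ^ 2 - 27)⌉₊ with hn
  have hn1 : 189 / (K ^ 2 - 27) < (n : ℝ) + 1 := (Nat.le_ceil _).trans_lt (by rw [hn]; linarith)
  have hrate : 27 + 189 / ((n : ℝ) + 1) < K ^ 2 := by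
    have h1 : 189 / ((n : ℝ) + 1) < K ^ 2 - 27 := by
      rw [div_lt_iff₀ (by positivity)]
      have h2 := (div_lt_iff₀ (by linarith : (0 : ℝ) < K ^ 2 - 27)).mp hn1
      linarith
    linarith
  obtain ⟨γ, b, M, B, B', p, h, h', hmono, hB, hM, hb, hlo, hB', hexc, hDmono, hp, hpγ, hh, hf, hh', hf', hlt, hsize⟩ :=
    exists_violation n
  refine ⟨γ, b, M, M, B, B', p, h, h', hmono, hB, hM, hb, hlo, ?_, hB', hM, hexc, hDmono, hp, hpγ, hh, hf, hh', hf', hlt⟩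
  have hγ : 0 ≤ γ := hp.le.trans hpγ
  have h2 : (M * γ) ^ 2 < (K * b) ^ 2 := by
    rw [mul_pow, mul_pow]
    exact hsize.trans_lt (mul_lt_mul_of_pos_right hrate (by positivity))
  exact (lt_of_pow_lt_pow_left₀ 2 (by positivity) h2).le

/-- **THE THRESHOLD FORM OF (E49k) WITH ANY LARGER CONSTANT IS FALSE**: for `K > 3√3`, «`M·γ ≤ K·b` + the other hypotheses of `le_of_isotone_excess`
⟹ `h′ ≤ h`» fails. [folklore] -/
theorem not_le_of_isotone_excess_of_gt {K : ℝ} (hK : 3 * Real.sqrt 3 < K) :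
    ¬ ∀ (γ b M M' : ℝ) (B B' : (ℕ → ℝ) → ℝ) (p : ℝ) (h h' : ℕ → ℝ),
      (∀ u v : ℕ → ℝ, SeqBox γ u → SeqBox γ v → (∀ j, u j ≤ v j) → B u ≤ B v) →
      (∀ u u' : ℕ → ℝ, SeqBox γ u → SeqBox γ u' → ∀ D : ℝ, (∀ j, |u j - u' j| ≤ D) → |B u - B u'| ≤ M * D) →
      0 ≤ M → 0 < b → (∀ u, SeqBox γ u → b ≤ B u) → M * γ ≤ K * b →
      (∀ u u' : ℕ → ℝ, SeqBox γ u → SeqBox γ u' → ∀ D : ℝ, (∀ j, |u j - u' j| ≤ D) → |B' u - B' u'| ≤ M' * D) → 0 ≤ M' →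
      (∀ u, SeqBox γ u → B u ≤ B' u) →
      (∀ u v : ℕ → ℝ, SeqBox γ u → SeqBox γ v → (∀ j, u j ≤ v j) → B' u - B u ≤ B' v - B v) →
      0 < p → p ≤ γ → SeqBox γ h → MemFlow B p h → SeqBox γ h' → MemFlow B' p h' → ∀ j, h' j ≤ h j := by
  intro H
  obtain ⟨γ, b, M, M', B, B', p, h, h', hmono, hB, hM, hb, hlo, hsmall, hB', hM', hexc, hDmono, hp, hpγ, hh, hf, hh', hf', hlt⟩ :=
    exists_violation_of_gt hK
  exact absurd (H γ b M M' B B' p h h' hmono hB hM hb hlo hsmall hB' hM' hexc hDmono hp hpγ hh hf hh' hf' 1) (not_le.mpr hlt)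

/-- **THE EXACT CLASS CONSTANT.**  «`B` isotone with zeroth moment `M` and floor `b` on ]0,γ], `M·γ ≤ C·b`, `B′ ≥ B` with a zeroth moment and an
isotone excess, `h`, `h′` box solutions from one pin ⟹ `h′ ≤ h` at every scale» HOLDS for `C = 3√3` ((E49k) `le_of_isotone_excess`, BY NAME) and FAILS
for every `C > 3√3` (`not_le_of_isotone_excess_of_gt`). [folklore] -/
theorem threshold_exact (C : ℝ) :
    (∀ (γ b M M' : ℝ) (B B' : (ℕ → ℝ) → ℝ) (p : ℝ) (h h' : ℕ → ℝ),
      (∀ u v : ℕ → ℝ, SeqBox γ u → SeqBox γ v → (∀ j, u j ≤ v j) → B u ≤ B v) →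
      (∀ u u' : ℕ → ℝ, SeqBox γ u → SeqBox γ u' → ∀ D : ℝ, (∀ j, |u j - u' j| ≤ D) → |B u - B u'| ≤ M * D) →
      0 ≤ M → 0 < b → (∀ u, SeqBox γ u → b ≤ B u) → M * γ ≤ C * b →
      (∀ u u' : ℕ → ℝ, SeqBox γ u → SeqBox γ u' → ∀ D : ℝ, (∀ j, |u j - u' j| ≤ D) → |B' u - B' u'| ≤ M' * D) → 0 ≤ M' →
      (∀ u, SeqBox γ u → B u ≤ B' u) →
      (∀ u v : ℕ → ℝ, SeqBox γ u → SeqBox γ v → (∀ j, u j ≤ v j) → B' u - B u ≤ B' v - B v) →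
      0 < p → p ≤ γ → SeqBox γ h → MemFlow B p h → SeqBox γ h' → MemFlow B' p h' → ∀ j, h' j ≤ h j) ↔ C ≤ 3 * Real.sqrt 3 := by
  constructor
  · intro H
    by_contra hC
    exact not_le_of_isotone_excess_of_gt (not_le.mp hC) H
  · intro hC γ b M M' B B' p h h' hmono hB hM hb hlo hsmall hB' hM' hexc hDmono hp hpγ hh hf hh' hf' j
    exact le_of_isotone_excess hmono hB hM hb hlo
      (hsmall.trans (mul_le_mul_of_nonneg_right hC hb.le)) hB' hM' hexc hDmono hp hpγ hh hf hh' hf' j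

end Summit.QuantumFields.BalabanUV.Beta.EriceRemainderEnclosureHistoryAutonomyComparisonIsotoneExcessSharpEnd
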